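import Summits.AtomisticToContinuum.BoseEinsteinCondensation.Theses.BECModePrice

/-!
# Strategist census sketch (gen 1, instance `s1`, bet route BECModePrice) — crux `BoundaryTransferWeak`
(stmt-AtomisticToContinuum-0827)

Typed forms of the STRENGTHEN / DECOMPOSITION candidates examined in `STRATEGY-CENSUS.md` rev 3
(§Strengthen S⁺₁–S⁺₃, §Decomposition D12–D13). Definitions only (plus two one-line logical remarks);
nothing here is claimed true — the census records why each candidate gives no leverage on THIS step.
Namespace kept disjoint from the r1 instance's `…Cruxes.BoundaryTransferWeak.Census` (file `CensusSketch.lean`).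
-/

noncomputable section

namespace Summit.AtomisticToContinuum.BoseEinsteinCondensation.Cruxes.BoundaryTransferWeak.CensusS1

open Literature.MathematicalPhysics.QuantumManyBody.BoseGas
open _root_.MeasureTheory _root_.Filter
open scoped ENNReal NNReal

/-- `A(v)`: the crux's antecedent at one potential (δ-robust constant-mode torus BEC at all small
densities), verbatim the hypothesis of `BECModePrice.BoundaryTransferWeak`. [folklore] -/
def TorusBEC (v : ℝ → ℝ≥0∞) : Prop :=
  ∃ ρ₀ : ℝ, 0 < ρ₀ ∧ ∀ ρ : ℝ, 0 < ρ → ρ < ρ₀ → ∃ c : ℝ, 0 < c ∧ ∀ᶠ N : ℕ in atTop,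
    ∃ δ : ℝ≥0∞, 0 < δ ∧ ∀ Ψ : PeriodicTrialState N (sideLength ρ N),
      periodicEnergy v Ψ ≤ periodicGroundStateEnergy v N (sideLength ρ N) + δ →
        ENNReal.ofReal (c * N) ≤ condensateOccupation N (sideLength ρ N) Ψ.ψ

/-- `B(v)`: the crux's consequent at one potential = the Statement's body at `v`. [folklore] -/
def DirichletBEC (v : ℝ → ℝ≥0∞) : Prop :=
  ∃ ρ₀ : ℝ, 0 < ρ₀ ∧ ∀ ρ : ℝ, 0 < ρ → ρ < ρ₀ → HasGroundStateBEC v ρ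

/-- The crux is literally `∀ v adm, A(v) → B(v)` (also for the BECModePrice copy). [folklore] -/
theorem crux_iff :
    Theses.BECModePrice.BoundaryTransferWeak ↔
      ∀ v : ℝ → ℝ≥0∞, IsRepulsiveFiniteRange v → TorusBEC v → DirichletBEC v :=
  Iff.rfl

/-! ## §Strengthen S⁺₁ / §Decomposition D12 — surface-robust MODE-FREE torus BEC

`A⁺_K(v)`: on the torus of side `L_N + R` (room for the wall layer), every periodic state within
`K · N^{2/3}` of the periodic ground-state energy has SOME mode occupied `≥ c N` (mode-free: a sup of
cell occupations over normalised measurable modes). With the glue "a Dirichlet δ-near-minimiser of the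
box of side `L_N`, zero-extended, is such a state once `K ≥ K_wall(v, ρ)`" this would give `B(v)`
WITHOUT comparing laws. Recorded verdict (census): `A → A⁺` is a landscape statement (it must exclude
every de-condensation mechanism cheaper than `K` domain walls) — strictly HARDER than the crux; the
δ-erasure of `A` gives it no purchase on `A⁺`. -/

/-- Mode-free occupation on the cell: `sup_φ ⟨φ, γ_Ψ φ⟩` over normalised measurable modes on the cell
of side `L` (the torus analogue of `maxOccupation`). [folklore] -/
def cellMaxOccupation (N : ℕ) (L : ℝ) (Ψ : Config N → ℂ) : ℝ≥0∞ :=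
  ⨆ (φ : Space → ℂ) (_ : AEStronglyMeasurable φ volume ∧
      ∫⁻ x in cell L, (‖φ x‖₊ : ℝ≥0∞) ^ 2 = 1), cellOccupation N L φ Ψ

/-- S⁺₁ `SurfaceRobustTorusBEC v`: for every surface budget `K` and padding `R ≥ 0`, below some
density, eventually in `N`, every periodic state on the torus of side `L_N + R` whose energy is within
`K N^{2/3}` of the periodic ground-state energy has a mode occupied `≥ c N`. [folklore] -/
def SurfaceRobustTorusBEC (v : ℝ → ℝ≥0∞) : Prop :=
  ∀ K R : ℝ, 0 < K → 0 ≤ R → ∃ ρ₁ : ℝ, 0 < ρ₁ ∧ ∀ ρ : ℝ, 0 < ρ → ρ < ρ₁ → ∃ c : ℝ, 0 < c ∧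
    ∀ᶠ N : ℕ in atTop, ∀ Ψ : PeriodicTrialState N (sideLength ρ N + R),
      periodicEnergy v Ψ ≤ periodicGroundStateEnergy v N (sideLength ρ N + R) +
          ENNReal.ofReal (K * (N : ℝ) ^ ((2 : ℝ) / 3)) →
        ENNReal.ofReal (c * N) ≤ cellMaxOccupation N (sideLength ρ N + R) Ψ.ψ

/-- D12's glue piece `WallEmbedding v`: surface-robust mode-free torus BEC implies Dirichlet
ground-state BEC (zero-extension of box states to the padded torus + `E₀^D(N,L) ≤ E₀^per(N,L+R) + K N^{2/3}`
by a cut-off periodic near-minimiser + `maxOccupation = cellMaxOccupation` on box-supported states).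
Provable-now in principle (cut-off states: `BoseGasCutoffState*`), size L. [folklore] -/
def WallEmbedding (v : ℝ → ℝ≥0∞) : Prop :=
  SurfaceRobustTorusBEC v → DirichletBEC v

/-- D12 as a split has ONE research piece which already implies the parent through provable glue —
the `strengthen` shape, not a decomposition: -/
theorem crux_of_D12 (h₁ : ∀ v, IsRepulsiveFiniteRange v → TorusBEC v → SurfaceRobustTorusBEC v)
    (h₂ : ∀ v, IsRepulsiveFiniteRange v → WallEmbedding v) :
    Theses.BECModePrice.BoundaryTransferWeak :=
  fun v hv hA => h₂ v hv (h₁ v hv hA)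

/-! ## §Strengthen S⁺₂ / §Decomposition D13 — Dirichlet SINE-mode softening price (cone-specific)

The BECModePrice thesis transplanted to the box in the Laplacian frame: softening one Dirichlet sine
mode `p ≠ (1,1,1)` by half its excitation energy `½(ε_p − ε_{111})`, `ε_p = π²|p|²/L²`, lowers `E₀^D`
by at most `Cρ`. With the sine-lattice count it would give `B(v)` with `A` idle (so as a split of
0827 it is a costume); worse, it is FALSE whenever `B(v)` holds with a flat bulk condensate profile:
the interacting Dirichlet condensate mode has overlap² `≈ (8/(9π²))·(8/π²)² ≈ 0.059` with EACH of the
sine modes `(3,1,1), (1,3,1), (1,1,3)`, so `½(ε_{311} − ε_{111}) n_{311}(Ψ_D) ≈ 2.3·c·N/L² = 2.3 c ρ L ≫ Cρ`.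
Recorded so that nobody re-derives "bypass 0827 by pricing sine modes" for this route. -/

/-- The `L²((0,L)³)`-normalised Dirichlet sine mode with multi-index `p ∈ ℕ³` (entries `≥ 1` intended). [folklore] -/
def sineMode (L : ℝ) (p : Fin 3 → ℕ) (x : Space) : ℂ :=
  ((Real.sqrt ((2 / L) ^ 3) * ∏ k : Fin 3, Real.sin (Real.pi * (p k : ℝ) * x k / L) : ℝ) : ℂ)

/-- S⁺₂ `DirichletSineModePrice v` (recorded as FALSE-in-substance for interacting `v`, see above). [folklore] -/
def DirichletSineModePrice (v : ℝ → ℝ≥0∞) : Prop :=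
  ∃ C : ℝ, 0 < C ∧ ∃ ρ₀ : ℝ, 0 < ρ₀ ∧ ∀ ρ : ℝ, 0 < ρ → ρ < ρ₀ → ∀ᶠ N : ℕ in atTop,
    ∀ p : Fin 3 → ℕ, (∀ k, 1 ≤ p k) → p ≠ (fun _ => 1) → ∀ Ψ : TrialState N (sideLength ρ N),
      (let L : ℝ := sideLength ρ N
       groundStateEnergy v N L +
          2⁻¹ * ENNReal.ofReal (Real.pi ^ 2 / L ^ 2 * ((∑ k : Fin 3, ((p k : ℕ) : ℝ) ^ 2) - 3)) *
            occupation N (sineMode L p) Ψ.ψ ≤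
        energy v Ψ + ENNReal.ofReal (C * ρ))

end Summit.AtomisticToContinuum.BoseEinsteinCondensation.Cruxes.BoundaryTransferWeak.CensusS1

end
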